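import Literature.Topology.PlanarFoliations.Monotone
import HarnessLib

/-!
# ω-limit sets of open leaves of a bi-oriented planar foliation: no self-accumulation

Topic: Topology / PlanarFoliations, sequel to `Monotone.lean`. For an open leaf `L = F.Leaf x`
of a bi-oriented foliation of a plane domain `X ↪ ℂ` (embedding `ι`), the **forward half-leaves**
`fwd p = {q | p ≤ q}` and the **ω-limit set** `omegaSet = ⋂ₚ closure (ι '' fwd p) ⊆ ℂ`.

Main result (the first theorem of Poincaré–Bendixson theory):

* `not_mem_omegaSet_self` (**proved**): **an open leaf does not accumulate on itself** — no
  point of `L` lies in the ω-limit set of `L`. If `q ∈ L` were an ω-limit point, the vertical of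
  a flow box through `q` would be crossed after `q` at heights arbitrarily close to the height of
  `q`, on both sides eventually excluded by the monotonicity of crossings (`ht_not_mem_Ioo`):
  after a crossing `q₁` above and a later crossing `r₂` below (say), every later crossing avoids
  the open interval `(ht r₂, ht q₁) ∋ ht q`.

Auxiliary: `exists_crossing_after` manufactures, from ω-accumulation at `q`, crossings of the
vertical through `q` after any given crossing, at heights `≠ ht q` and arbitrarily close to it
(points of a far forward half-leaf near `pt q` lie on plaques of the box at nearby heights, whose
points on the vertical are crossings; order bookkeeping by order-convexity of plaques).
All statements are [folklore] (Bendixson 1901; e.g. Camacho–Lins Neto Ch. VI §4, Hector–Hirsch A).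
-/

noncomputable section

open Set Filter Function
open _root_.Topology
open Literature.Topology.FourManifolds Literature.Topology.FourManifolds.Foliation
  Literature.Topology.FourManifolds.OneManifold Literature.Topology.PlaneTopology

namespace Literature.Topology.PlanarFoliations

variable {X : Type*} [TopologicalSpace X] [T2Space X] [SecondCountableTopology X] {F : Foliation ℝ X} {x : X}
variable [NoncompactSpace (F.Leaf x)] {hbi : IsBiOriented F}
variable {e : OpenPartialHomeomorph X (ℝ × ℝ)} {u₀ : ℝ} {ι : X → ℂ}

/-! ## Forward half-leaves and the ω-limit set -/

variable (hbi) in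
/-- **The forward half-leaf** from `p`: the points `q ≥ p` of the open leaf. [folklore] -/
def fwd (p : F.Leaf x) : Set (F.Leaf x) := {q | ¬ leafLT hbi q p}

/-- `p` is in its forward half-leaf. [folklore] -/
theorem mem_fwd_self (p : F.Leaf x) : p ∈ fwd hbi p := leafLT_irrefl p

/-- Points after `p` are in its forward half-leaf. [folklore] -/
theorem mem_fwd_of_leafLT {p q : F.Leaf x} (h : leafLT hbi p q) : q ∈ fwd hbi p := leafLT_asymm h

/-- Forward half-leaves decrease. [folklore] -/
theorem fwd_mono {p p' : F.Leaf x} (h : ¬ leafLT hbi p' p) : fwd hbi p' ⊆ fwd hbi p := fun q hq hqp ↦ by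
  rcases not_leafLT_iff.1 h with h' | h'
  · exact hq (leafLT_trans hqp h')
  · exact hq (h' ▸ hqp)

/-- **The ω-limit set** of the open leaf `F.Leaf x` in the plane: the points of `ℂ` approached
by every forward half-leaf. [folklore] -/
def omegaSet (hbi : IsBiOriented F) (ι : X → ℂ) (x : X) [NoncompactSpace (F.Leaf x)] : Set ℂ :=
  ⋂ p : F.Leaf x, closure ((fun q : F.Leaf x ↦ ι (Leaf.pt q)) '' fwd hbi p)

/-- The ω-limit set is closed. [folklore] -/
theorem isClosed_omegaSet : IsClosed (omegaSet hbi ι x) := isClosed_iInter fun _ ↦ isClosed_closure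

/-- Membership in the ω-limit set. [folklore] -/
theorem mem_omegaSet_iff {z : ℂ} :
    z ∈ omegaSet hbi ι x ↔ ∀ p : F.Leaf x, z ∈ closure ((fun q : F.Leaf x ↦ ι (Leaf.pt q)) '' fwd hbi p) := mem_iInter

/-! ## Crossings manufactured from ω-accumulation -/

/-- The point of the leaf on the vertical `u = u₀` of the box `e` at the height of `z` (a point
of the leaf in the box): a crossing on the plaque of `z`. [folklore] -/
def toVert (he : e ∈ F.atlas) (u₀ : ℝ) (z : F.Leaf x) (hz : Leaf.pt z ∈ e.source) : F.Leaf x :=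
  Leaf.mk (e.symm (u₀, ht e z)) (F.plaque_subset_leaf_of_mem he z.2 (mem_plaque_self hz) (plaqueMap_mem_plaque F he _ u₀))

omit [T2Space X] [SecondCountableTopology X] [NoncompactSpace (F.Leaf x)] in
/-- The underlying point of `toVert`. [folklore] -/
theorem pt_toVert (he : e ∈ F.atlas) (z : F.Leaf x) (hz : Leaf.pt z ∈ e.source) :
    Leaf.pt (toVert he u₀ z hz) = e.symm (u₀, ht e z) := rfl

omit [T2Space X] [SecondCountableTopology X] [NoncompactSpace (F.Leaf x)] in
/-- `toVert` is a crossing. [folklore] -/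
theorem isCrossing_toVert (he : e ∈ F.atlas) (z : F.Leaf x) (hz : Leaf.pt z ∈ e.source) :
    IsCrossing e u₀ (toVert he u₀ z hz) := by
  refine ⟨?_, ?_⟩
  · rw [pt_toVert]; exact e.map_target (by rw [F.target_eq e he]; exact mem_univ _)
  · rw [pt_toVert, e.right_inv (by rw [F.target_eq e he]; exact mem_univ _)]

omit [T2Space X] [SecondCountableTopology X] [NoncompactSpace (F.Leaf x)] in
/-- The height of `toVert`. [folklore] -/
theorem ht_toVert (he : e ∈ F.atlas) (z : F.Leaf x) (hz : Leaf.pt z ∈ e.source) : ht e (toVert he u₀ z hz) = ht e z := by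
  show (e (Leaf.pt (toVert he u₀ z hz))).2 = ht e z
  rw [pt_toVert, e.right_inv (by rw [F.target_eq e he]; exact mem_univ _)]

omit [T2Space X] [SecondCountableTopology X] [NoncompactSpace (F.Leaf x)] in
/-- `z` and its vertical point lie on one leaf arc (the plaque of `z`). [folklore] -/
theorem mem_leafArc_source_toVert (he : e ∈ F.atlas) (z : F.Leaf x) (hz : Leaf.pt z ∈ e.source) :
    ∃ h : plaque e (ht e z) ⊆ F.leaf x, z ∈ (leafArc e (ht e z) h he).source ∧ toVert he u₀ z hz ∈ (leafArc e (ht e z) h he).source := by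
  refine ⟨F.plaque_subset_leaf_of_mem he z.2 (mem_plaque_self hz), ?_, ?_⟩
  · rw [mem_leafArc_source_iff]; exact mem_plaque_self hz
  · rw [mem_leafArc_source_iff]; exact plaqueMap_mem_plaque F he _ u₀

/-- **Order bookkeeping on a plaque**: if `p₀` is not on the plaque of `z` and `p₀ < z`, then the
vertical point of `z` is after `p₀` too (plaques are order-convex). [folklore] -/
theorem leafLT_toVert (he : e ∈ F.atlas) {p₀ z : F.Leaf x} (hz : Leaf.pt z ∈ e.source) (hlt : leafLT hbi p₀ z)
    (hp₀ : Leaf.pt p₀ ∉ plaque e (ht e z)) : leafLT hbi p₀ (toVert he u₀ z hz) := by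
  obtain ⟨h, hzs, hcs⟩ := mem_leafArc_source_toVert (u₀ := u₀) he z hz
  rcases leafLT_trichotomy (hbi := hbi) p₀ (toVert he u₀ z hz) with hlt' | heq | hgt
  · exact hlt'
  · exfalso
    apply hp₀
    rw [heq]
    exact (mem_leafArc_source_iff h he).1 hcs
  · exfalso
    have hmem := mem_leafArc_source_of_between he h hcs hzs (leafLT_asymm hgt) (leafLT_asymm hlt)
    exact hp₀ ((mem_leafArc_source_iff h he).1 hmem)

omit [T2Space X] [SecondCountableTopology X] [NoncompactSpace (F.Leaf x)] in
/-- The plane embedding composed with the box inverse is an open embedding of `ℝ²`. [folklore] -/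
theorem isOpenEmbedding_symm (he : e ∈ F.atlas) (hι : IsOpenEmbedding ι) :
    IsOpenEmbedding (fun q : ℝ × ℝ ↦ ι (e.symm q)) := by
  have h1 : IsOpenEmbedding (fun q : ℝ × ℝ ↦ e.symm q) := by
    have hs : e.symm.source = univ := by rw [e.symm_source, F.target_eq e he]
    have := e.symm.isOpenEmbedding_restrict
    rw [hs] at this
    exact this.comp (Homeomorph.Set.univ (ℝ × ℝ)).symm.isOpenEmbedding
  exact hι.comp h1

/-- **Crossings after a crossing, from ω-accumulation.** If `pt q` is an ω-limit point of its own
open leaf, then after any point `p₀ ≥ q` there are crossings of the vertical through `q` at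
heights `≠ ht q` within any `δ ≤ |ht p₀ - ht q|` (or any `δ` when `p₀ = q`) of `ht q`. [folklore] -/
theorem exists_crossing_after (he : e ∈ F.atlas) (hι : IsOpenEmbedding ι) {q : F.Leaf x} (hq : IsCrossing e u₀ q)
    (hω : ι (Leaf.pt q) ∈ omegaSet hbi ι x) {p₀ : F.Leaf x} (hp₀q : ¬ leafLT hbi p₀ q)
    {δ : ℝ} (hδ : 0 < δ) (hδ' : p₀ = q ∨ δ ≤ |ht e p₀ - ht e q|) :
    ∃ c, leafLT hbi p₀ c ∧ IsCrossing e u₀ c ∧ ht e c ≠ ht e q ∧ |ht e c - ht e q| < δ := by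
  -- the plaque `S` of `q` as a leaf arc
  have hqs : Leaf.pt q ∈ e.source := hq.1
  set tq := ht e q with htq
  have hsub : plaque e tq ⊆ F.leaf x := F.plaque_subset_leaf_of_mem he q.2 (mem_plaque_self hqs)
  set cq := leafArc e tq hsub he with hcq
  have hqS : q ∈ cq.source := (mem_leafArc_source_iff hsub he).2 (mem_plaque_self hqs)
  -- Case (b): the plaque is unbounded above in the leaf — then `q` is not an ω-limit point
  by_cases hbdd : ∃ p₁ : F.Leaf x, ∀ s ∈ cq.source, leafLT hbi s p₁
  swap
  · exfalso
    push Not at hbdd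
    -- the forward half-leaf from the plaque point `p := e.symm (u₀ + 1, tq)` lies on the plaque, to the right of `u₀ + 1`
    set p : F.Leaf x := Leaf.mk (e.symm (u₀ + 1, tq)) (hsub (plaqueMap_mem_plaque F he _ _)) with hp
    have hpS : p ∈ cq.source := (mem_leafArc_source_iff hsub he).2 (plaqueMap_mem_plaque F he _ _)
    have hcp : cq p = u₀ + 1 := by
      rw [leafArc_apply hsub he hpS]
      show (e (e.symm (u₀ + 1, tq))).1 = u₀ + 1
      rw [e.right_inv (by rw [F.target_eq e he]; exact mem_univ _)]
    have hfwd : ∀ z ∈ fwd hbi p, z ∈ cq.source ∧ u₀ + 1 ≤ cq z := by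
      intro z hz
      obtain ⟨s, hsS, hzs⟩ := hbdd z
      have hzS : z ∈ cq.source := mem_leafArc_source_of_between he hsub hpS hsS hz hzs
      refine ⟨hzS, ?_⟩
      rw [← hcp]
      rcases not_leafLT_iff.1 hz with h | h
      · exact ((leafArc_lt_iff (hbi := hbi) he hsub hpS hzS).2 h).le
      · rw [h]
    -- so its image stays in `ι ∘ e.symm '' ([u₀ + 1, ∞) × {tq})`, a closed set of `ι ∘ e.symm '' ℝ²` missing `ι pt q`
    have hcl := (mem_omegaSet_iff.1 hω) p
    set Φ := fun w : ℝ × ℝ ↦ ι (e.symm w) with hΦ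
    have hΦ' : IsOpenEmbedding Φ := isOpenEmbedding_symm he hι
    have himg : (fun z : F.Leaf x ↦ ι (Leaf.pt z)) '' fwd hbi p ⊆ Φ '' (Ici (u₀ + 1) ×ˢ {tq}) := by
      rintro _ ⟨z, hz, rfl⟩
      obtain ⟨hzS, hle⟩ := hfwd z hz
      have hzpl : Leaf.pt z ∈ plaque e tq := (mem_leafArc_source_iff hsub he).1 hzS
      refine ⟨(cq z, tq), ⟨hle, rfl⟩, ?_⟩
      show ι (e.symm (cq z, tq)) = ι (Leaf.pt z)
      rw [leafArc_apply hsub he hzS, ← hzpl.2, show ((e (Leaf.pt z)).1, (e (Leaf.pt z)).2) = e (Leaf.pt z) from rfl,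
        e.left_inv hzpl.1]
    have hclosed : IsClosed (Φ '' (Ici (u₀ + 1) ×ˢ {tq}) ∪ (range Φ)ᶜ) := by
      -- `Φ '' C` for `C` closed is closed in the open set `range Φ`; adding the complement closes it up
      have hC : IsClosed (Ici (u₀ + 1) ×ˢ ({tq} : Set ℝ)) := isClosed_Ici.prod isClosed_singleton
      rw [← isOpen_compl_iff, compl_union, compl_compl]
      have : (Φ '' (Ici (u₀ + 1) ×ˢ {tq}))ᶜ ∩ range Φ = Φ '' (Ici (u₀ + 1) ×ˢ {tq})ᶜ := by
        ext w
        constructor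
        · rintro ⟨hw, ⟨v, rfl⟩⟩
          exact ⟨v, fun hv ↦ hw ⟨v, hv, rfl⟩, rfl⟩
        · rintro ⟨v, hv, rfl⟩
          exact ⟨fun ⟨v', hv', hEq⟩ ↦ hv (hΦ'.injective hEq ▸ hv'), v, rfl⟩
      rw [this]
      exact hΦ'.isOpenMap _ hC.isOpen_compl
    have hmem : ι (Leaf.pt q) ∈ Φ '' (Ici (u₀ + 1) ×ˢ {tq}) ∪ (range Φ)ᶜ :=
      (hclosed.closure_subset_iff.2 (himg.trans subset_union_left)) hcl
    rcases hmem with ⟨⟨u, t⟩, ⟨hu, -⟩, hEq⟩ | hnot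
    · have hq' : Φ (u₀, tq) = ι (Leaf.pt q) := by
        show ι (e.symm (u₀, tq)) = ι (Leaf.pt q); rw [hq.pt_eq]
      have := hΦ'.injective (hEq.trans hq'.symm)
      have hu' : u = u₀ := (Prod.ext_iff.1 this).1
      have hu'' : u₀ + 1 ≤ u := hu
      linarith
    · exact hnot ⟨(u₀, tq), by show ι (e.symm (u₀, tq)) = ι (Leaf.pt q); rw [hq.pt_eq]⟩
  -- Case (a): a point `p₁` beyond the plaque; take `p₂ ≥ p₀, p₁`
  obtain ⟨p₁, hp₁⟩ := hbdd
  obtain ⟨p₂, hp₂₀, hp₂₁⟩ : ∃ p₂, ¬ leafLT hbi p₂ p₀ ∧ ¬ leafLT hbi p₂ p₁ := by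
    rcases leafLT_trichotomy (hbi := hbi) p₀ p₁ with h | h | h
    · exact ⟨p₁, leafLT_asymm h, leafLT_irrefl _⟩
    · exact ⟨p₁, h ▸ leafLT_irrefl _, leafLT_irrefl _⟩
    · exact ⟨p₀, leafLT_irrefl _, leafLT_asymm h⟩
  -- a small box around `(u₀, tq)` whose points of `fwd p₂` give the crossing
  set Φ := fun w : ℝ × ℝ ↦ ι (e.symm w) with hΦ
  have hΦ' : IsOpenEmbedding Φ := isOpenEmbedding_symm he hι
  set B : Set (ℝ × ℝ) := Ioo (u₀ - δ) (u₀ + δ) ×ˢ Ioo (tq - δ) (tq + δ) with hB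
  have hBo : IsOpen (Φ '' B) := hΦ'.isOpenMap _ (isOpen_Ioo.prod isOpen_Ioo)
  have hqB : ι (Leaf.pt q) ∈ Φ '' B :=
    ⟨(u₀, tq), ⟨⟨by linarith, by linarith⟩, by linarith, by linarith⟩, by show ι (e.symm (u₀, tq)) = _; rw [hq.pt_eq]⟩
  have hcl := (mem_omegaSet_iff.1 hω) p₂
  obtain ⟨_, ⟨⟨u, t⟩, ⟨hu, htB⟩, rfl⟩, ⟨z, hz, hzEq⟩⟩ := mem_closure_iff_nhds.1 hcl _ (hBo.mem_nhds hqB)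
  -- `z ∈ fwd p₂` with `pt z = e.symm (u, t)`
  have hzpt : Leaf.pt z = e.symm (u, t) := (hι.injective hzEq).symm ▸ rfl
  have hzs : Leaf.pt z ∈ e.source := by rw [hzpt]; exact e.map_target (by rw [F.target_eq e he]; exact mem_univ _)
  have hez : e (Leaf.pt z) = (u, t) := by rw [hzpt, e.right_inv (by rw [F.target_eq e he]; exact mem_univ _)]
  have hzt : ht e z = t := by show (e (Leaf.pt z)).2 = t; rw [hez]
  have hu' : u ∈ Ioo (u₀ - δ) (u₀ + δ) := hu
  have ht' : t ∈ Ioo (tq - δ) (tq + δ) := htB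
  -- `t ≠ tq`: otherwise `z` is on the plaque of `q`, before `p₁ ≤ p₂ ≤ z`
  have htne : t ≠ tq := by
    intro htt
    have hzS : z ∈ cq.source := (mem_leafArc_source_iff hsub he).2 ⟨hzs, by rw [hez, htt]⟩
    have h1 := hp₁ z hzS
    rcases not_leafLT_iff.1 hp₂₁ with h | h
    · exact hz (leafLT_trans h1 h)
    · exact hz (h ▸ h1)
  -- the crossing on the plaque of `z`
  refine ⟨toVert he u₀ z hzs, ?_, isCrossing_toVert he z hzs, by rw [ht_toVert, hzt]; exact htne, ?_⟩
  · -- `p₀ < toVert z`: `p₀ ≤ p₂ ≤ z`, `p₀ ≠ z`-plaque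
    have hp₀z : leafLT hbi p₀ z := by
      rcases not_leafLT_iff.1 hp₂₀ with h | h
      · rcases not_leafLT_iff.1 hz with h' | h'
        · exact leafLT_trans h h'
        · exact h' ▸ h
      · rcases not_leafLT_iff.1 hz with h' | h'
        · exact h ▸ h'
        · -- `p₀ = p₂ = z`: then `z` is a crossing at height `t` with `|t - tq| < δ ≤ |t - tq|`, absurd
          exfalso
          have hzp₀ : z = p₀ := (h.trans h').symm
          have htp₀ : ht e p₀ = t := by rw [← hzp₀]; exact hzt
          rcases hδ' with h0 | h0
          · apply htne
            rw [← htp₀, h0]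
          · rw [htp₀] at h0
            have : |t - tq| < δ := by rw [abs_lt]; constructor <;> linarith [ht'.1, ht'.2]
            linarith
    refine leafLT_toVert he hzs hp₀z ?_
    rintro ⟨-, hh⟩
    -- `p₀` on the plaque of `z` would have height `t`, but its height is `tq` or far from `tq`
    rw [hzt] at hh
    rcases hδ' with h0 | h0
    · subst h0
      exact htne (hh ▸ rfl)
    · have hh' : ht e p₀ = t := hh
      rw [hh'] at h0
      have : |t - tq| < δ := by rw [abs_lt]; constructor <;> linarith [ht'.1, ht'.2]
      linarith
  · rw [ht_toVert, hzt, abs_lt]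
    constructor <;> linarith [ht'.1, ht'.2]

/-! ## No self-accumulation -/

/-- **An open leaf of a bi-oriented planar foliation does not accumulate on itself**
(Poincaré–Bendixson): no point of the leaf is an ω-limit point of the leaf. [folklore] -/
theorem not_mem_omegaSet_self (hbi : IsBiOriented F) (hι : IsOpenEmbedding ι) (q : F.Leaf x) :
    ι (Leaf.pt q) ∉ omegaSet hbi ι x := by
  intro hω
  obtain ⟨e, he, hqs⟩ := F.exists_mem_source (Leaf.pt q)
  set u₀ := (e (Leaf.pt q)).1 with hu₀
  have hq : IsCrossing e u₀ q := ⟨hqs, rfl⟩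
  set tq := ht e q with htq
  -- a first crossing `q₁ > q` at height `t₁ ≠ tq`
  obtain ⟨q₁, hqq₁, hq₁, ht₁ne, -⟩ :=
    exists_crossing_after (hbi := hbi) he hι hq hω (leafLT_irrefl q) one_pos (Or.inl rfl)
  -- a later crossing `r₂` closer to `tq`: on the other side of `tq` (monotonicity)
  have hgap₁ : 0 < |ht e q₁ - tq| := abs_pos.2 (sub_ne_zero.2 ht₁ne)
  obtain ⟨r₂, hq₁r₂, hr₂, ht₂ne, ht₂lt⟩ :=
    exists_crossing_after (hbi := hbi) he hι hq hω (leafLT_asymm hqq₁) hgap₁ (Or.inr le_rfl)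
  have hM₁ := ht_not_mem_Ioo (hbi := hbi) (u₀ := u₀) he hι hqq₁ hq₁r₂ hq hq₁ hr₂
  -- a third crossing `r₃ > r₂` closer still: excluded on both sides
  have hgap₂ : 0 < |ht e r₂ - tq| := abs_pos.2 (sub_ne_zero.2 ht₂ne)
  obtain ⟨r₃, hr₂r₃, hr₃, ht₃ne, ht₃lt⟩ :=
    exists_crossing_after (hbi := hbi) he hι hq hω (leafLT_asymm (leafLT_trans hqq₁ hq₁r₂)) hgap₂ (Or.inr le_rfl)
  have hM₂ := ht_not_mem_Ioo (hbi := hbi) (u₀ := u₀) he hι (leafLT_trans hqq₁ hq₁r₂) hr₂r₃ hq hr₂ hr₃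
  have hM₃ := ht_not_mem_Ioo (hbi := hbi) (u₀ := u₀) he hι hq₁r₂ hr₂r₃ hq₁ hr₂ hr₃
  -- arithmetic: positions relative to `tq`
  simp only [mem_Ioo, not_and, not_lt] at hM₁ hM₂ hM₃
  rw [abs_lt] at ht₂lt ht₃lt
  rcases lt_or_gt_of_ne ht₁ne with h₁ | h₁
  · -- `t₁ < tq`: then `r₂` is above `tq` (not in `(t₁, tq)`), and `r₃` is trapped
    rw [abs_of_neg (sub_neg.2 h₁)] at ht₂lt hgap₁
    have h₂ : tq < ht e r₂ := by
      rcases lt_or_gt_of_ne ht₂ne with h | h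
      · exfalso
        have := hM₁ (by rw [min_eq_right h₁.le]; linarith [ht₂lt.1])
        rw [max_eq_left h₁.le] at this
        linarith
      · exact h
    rw [abs_of_pos (sub_pos.2 h₂)] at ht₃lt hgap₂
    rcases lt_or_gt_of_ne ht₃ne with h | h
    · -- `r₃` below `tq`, above `t₁`: in `(t₁, ht r₂)` — excluded by `hM₃`
      have := hM₃ (by rw [min_eq_left (h₁.trans h₂).le]; linarith [ht₃lt.1])
      rw [max_eq_right (h₁.trans h₂).le] at this
      linarith
    · -- `r₃` above `tq`, below `ht r₂`: in `(tq, ht r₂)` — excluded by `hM₂`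
      have := hM₂ (by rw [min_eq_left h₂.le]; exact h)
      rw [max_eq_right h₂.le] at this
      linarith [ht₃lt.2]
  · rw [abs_of_pos (sub_pos.2 h₁)] at ht₂lt hgap₁
    have h₂ : ht e r₂ < tq := by
      rcases lt_or_gt_of_ne ht₂ne with h | h
      · exact h
      · exfalso
        have := hM₁ (by rw [min_eq_left h₁.le]; exact h)
        rw [max_eq_right h₁.le] at this
        linarith [ht₂lt.2]
    rw [abs_of_neg (sub_neg.2 h₂)] at ht₃lt hgap₂
    rcases lt_or_gt_of_ne ht₃ne with h | h
    · have := hM₂ (by rw [min_eq_right h₂.le]; linarith [ht₃lt.1])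
      rw [max_eq_left h₂.le] at this
      linarith
    · have := hM₃ (by rw [min_eq_right (h₂.trans h₁).le]; linarith [ht₃lt.1])
      rw [max_eq_left (h₂.trans h₁).le] at this
      linarith [ht₃lt.2]

/-! ## Saturation of the ω-limit set -/

/-- **Plaque sliding**: if a point `y` of a flow box `e'` of the atlas is an ω-limit point of the
open leaf, so is every point of the plaque of `e'` through `y`. Points of far forward
half-leaves near `y` lie on plaques of `e'` at nearby heights, which also pass near `y'`; the
order bookkeeping uses order-convexity of plaques. [folklore] -/
theorem mem_omegaSet_of_mem_plaque {e' : OpenPartialHomeomorph X (ℝ × ℝ)} (he' : e' ∈ F.atlas) (hι : IsOpenEmbedding ι)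
    {y y' : X} (hy : ι y ∈ omegaSet hbi ι x) (hye : y ∈ e'.source) (hy' : y' ∈ plaque e' (e' y).2) :
    ι y' ∈ omegaSet hbi ι x := by
  set t := (e' y).2 with ht₀
  set u := (e' y).1 with hu
  set u' := (e' y').1 with hu'
  have hyeq : y = e'.symm (u, t) := by rw [show (u, t) = e' y from rfl, e'.left_inv hye]
  have hy'eq : y' = e'.symm (u', t) := by rw [← hy'.2, show (u', (e' y').2) = e' y' from rfl, e'.left_inv hy'.1]
  set Φ := fun w : ℝ × ℝ ↦ ι (e'.symm w) with hΦ
  have hΦ' : IsOpenEmbedding Φ := isOpenEmbedding_symm he' hι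
  rw [mem_omegaSet_iff]
  intro p
  rw [mem_closure_iff_nhds]
  intro N hN
  -- a box `B'` around `(u', t)` inside `N`
  have hN' : Φ ⁻¹' N ∈ 𝓝 (u', t) := hΦ'.continuous.continuousAt.preimage_mem_nhds (by rw [hΦ]; simp only; rw [← hy'eq]; exact hN)
  obtain ⟨δ₁, hδ₁, hball⟩ := Metric.mem_nhds_iff.1 hN'
  -- the reference point `p⁺ ≥ p` off the plaques of `e'` at heights near `t`, and the margin `δ`
  obtain ⟨p₂, δ, hpp₂, hδ, hδ₁', hoff⟩ : ∃ (p₂ : F.Leaf x) (δ : ℝ), ¬ leafLT hbi p₂ p ∧ 0 < δ ∧ δ ≤ δ₁ ∧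
      ∀ z : F.Leaf x, z ∈ fwd hbi p₂ → Leaf.pt z ∈ e'.source → |ht e' z - t| < δ →
        leafLT hbi p z ∧ Leaf.pt p ∉ plaque e' (ht e' z) := by
    by_cases hpe : Leaf.pt p ∈ e'.source
    swap
    · -- `p` outside the box: never on a plaque of `e'`
      refine ⟨p, δ₁, leafLT_irrefl p, hδ₁, le_rfl, fun z hz hze _ ↦ ⟨?_, fun h ↦ hpe h.1⟩⟩
      rcases not_leafLT_iff.1 hz with h | h
      · exact h
      · exfalso; exact hpe (h ▸ hze)
    by_cases htp : ht e' p = t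
    swap
    · -- `p` in the box at a height `≠ t`: margin below `|ht p - t|`
      have hgap : 0 < |ht e' p - t| := abs_pos.2 (sub_ne_zero.2 htp)
      refine ⟨p, min δ₁ |ht e' p - t|, leafLT_irrefl p, lt_min hδ₁ hgap, min_le_left _ _, fun z hz hze hzt ↦ ?_⟩
      have hne : ht e' z ≠ ht e' p := by
        intro h; rw [h] at hzt; linarith [min_le_right δ₁ |ht e' p - t|]
      refine ⟨?_, fun h ↦ hne ?_⟩
      · rcases not_leafLT_iff.1 hz with h | h
        · exact h
        · exfalso; exact hne (by rw [h])
      · exact h.2.symm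
    · -- `p` on the plaque of `y`: go beyond the plaque (it is bounded above, else `y` is not an ω-limit point)
      have hsub : plaque e' t ⊆ F.leaf x := by
        convert F.plaque_subset_leaf_of_mem he' p.2 (mem_plaque_self hpe) using 2
        exact htp.symm
      set c := leafArc e' t hsub he' with hc
      have hpS : p ∈ c.source := (mem_leafArc_source_iff hsub he').2 ⟨hpe, htp⟩
      by_cases hbdd : ∃ p₁ : F.Leaf x, ∀ w ∈ c.source, leafLT hbi w p₁
      swap
      · exfalso
        push Not at hbdd
        -- `y` would lie to the right of every point of the plaque
        have key : ∀ q ∈ c.source, c q ≤ u := by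
          intro q hqS
          have hfwd : ∀ z ∈ fwd hbi q, z ∈ c.source ∧ c q ≤ c z := by
            intro z hz
            obtain ⟨w, hwS, hzw⟩ := hbdd z
            have hzS : z ∈ c.source := mem_leafArc_source_of_between he' hsub hqS hwS hz hzw
            refine ⟨hzS, ?_⟩
            rcases not_leafLT_iff.1 hz with h | h
            · exact ((leafArc_lt_iff (hbi := hbi) he' hsub hqS hzS).2 h).le
            · rw [h]
          have hcl := (mem_omegaSet_iff.1 hy) q
          have himg : (fun z : F.Leaf x ↦ ι (Leaf.pt z)) '' fwd hbi q ⊆ Φ '' (Ici (c q) ×ˢ {t}) := by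
            rintro _ ⟨z, hz, rfl⟩
            obtain ⟨hzS, hle⟩ := hfwd z hz
            have hzpl : Leaf.pt z ∈ plaque e' t := (mem_leafArc_source_iff hsub he').1 hzS
            refine ⟨(c z, t), ⟨hle, rfl⟩, ?_⟩
            show ι (e'.symm (c z, t)) = ι (Leaf.pt z)
            rw [leafArc_apply hsub he' hzS, ← hzpl.2, show ((e' (Leaf.pt z)).1, (e' (Leaf.pt z)).2) = e' (Leaf.pt z) from rfl,
              e'.left_inv hzpl.1]
          have hclosed : IsClosed (Φ '' (Ici (c q) ×ˢ {t}) ∪ (range Φ)ᶜ) := by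
            have hC : IsClosed (Ici (c q) ×ˢ ({t} : Set ℝ)) := isClosed_Ici.prod isClosed_singleton
            rw [← isOpen_compl_iff, compl_union, compl_compl]
            have : (Φ '' (Ici (c q) ×ˢ {t}))ᶜ ∩ range Φ = Φ '' (Ici (c q) ×ˢ {t})ᶜ := by
              ext w
              constructor
              · rintro ⟨hw, ⟨v, rfl⟩⟩
                exact ⟨v, fun hv ↦ hw ⟨v, hv, rfl⟩, rfl⟩
              · rintro ⟨v, hv, rfl⟩
                exact ⟨fun ⟨v', hv', hEq⟩ ↦ hv (hΦ'.injective hEq ▸ hv'), v, rfl⟩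
            rw [this]
            exact hΦ'.isOpenMap _ hC.isOpen_compl
          have hmem : ι y ∈ Φ '' (Ici (c q) ×ˢ {t}) ∪ (range Φ)ᶜ :=
            (hclosed.closure_subset_iff.2 (himg.trans subset_union_left)) hcl
          rcases hmem with ⟨⟨v, t'⟩, ⟨hv, -⟩, hEq⟩ | hnot
          · have h1 : Φ (v, t') = Φ (u, t) := by rw [hEq, hyeq]
            have := hΦ'.injective h1
            rw [(Prod.ext_iff.1 this).1] at hv
            exact hv
          · exact (hnot ⟨(u, t), by rw [hyeq]⟩).elim
        -- but the plaque contains the point at leaf coordinate `u + 1`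
        set q : F.Leaf x := Leaf.mk (e'.symm (u + 1, t)) (hsub (plaqueMap_mem_plaque F he' _ _)) with hq
        have hqS : q ∈ c.source := (mem_leafArc_source_iff hsub he').2 (plaqueMap_mem_plaque F he' _ _)
        have hcq : c q = u + 1 := by
          rw [leafArc_apply hsub he' hqS]
          show (e' (e'.symm (u + 1, t))).1 = u + 1
          rw [e'.right_inv (by rw [F.target_eq e' he']; exact mem_univ _)]
        have := key q hqS
        linarith
      obtain ⟨p₁, hp₁⟩ := hbdd
      have hpp₁ : leafLT hbi p p₁ := hp₁ p hpS
      refine ⟨p₁, δ₁, leafLT_asymm hpp₁, hδ₁, le_rfl, fun z hz hze hzt ↦ ?_⟩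
      have hpz : leafLT hbi p z := by
        rcases not_leafLT_iff.1 hz with h | h
        · exact leafLT_trans hpp₁ h
        · exact h ▸ hpp₁
      refine ⟨hpz, fun hmem ↦ ?_⟩
      -- `p` on the plaque of `z` means `ht z = t`, so `z` is on the plaque of `p`, before `p₁ ≤ z`: absurd
      have hzt' : ht e' z = t := hmem.2.symm.trans htp
      have hzS : z ∈ c.source := (mem_leafArc_source_iff hsub he').2 ⟨hze, hzt'⟩
      have h1 := hp₁ z hzS
      rcases not_leafLT_iff.1 hz with h | h
      · exact leafLT_asymm h1 h
      · rw [h] at h1; exact leafLT_irrefl _ h1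
  -- points of `fwd p₂` in the box `B` of size `δ` around `(u, t)`
  set B : Set (ℝ × ℝ) := Ioo (u - δ) (u + δ) ×ˢ Ioo (t - δ) (t + δ) with hB
  have hBo : IsOpen (Φ '' B) := hΦ'.isOpenMap _ (isOpen_Ioo.prod isOpen_Ioo)
  have hyB : ι y ∈ Φ '' B := ⟨(u, t), ⟨⟨by linarith, by linarith⟩, by linarith, by linarith⟩, by rw [hyeq]⟩
  have hcl := (mem_omegaSet_iff.1 hy) p₂
  obtain ⟨_, ⟨⟨v, τ⟩, ⟨-, hτ⟩, rfl⟩, ⟨z, hz, hzEq⟩⟩ := mem_closure_iff_nhds.1 hcl _ (hBo.mem_nhds hyB)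
  have hzpt : Leaf.pt z = e'.symm (v, τ) := (hι.injective hzEq).symm ▸ rfl
  have hzs : Leaf.pt z ∈ e'.source := by rw [hzpt]; exact e'.map_target (by rw [F.target_eq e' he']; exact mem_univ _)
  have hez : e' (Leaf.pt z) = (v, τ) := by rw [hzpt, e'.right_inv (by rw [F.target_eq e' he']; exact mem_univ _)]
  have hzt : ht e' z = τ := by show (e' (Leaf.pt z)).2 = τ; rw [hez]
  have hτ' : τ ∈ Ioo (t - δ) (t + δ) := hτ
  have hτabs : |ht e' z - t| < δ := by rw [hzt, abs_lt]; constructor <;> linarith [hτ'.1, hτ'.2]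
  obtain ⟨hpz, hpoff⟩ := hoff z hz hzs hτabs
  -- slide along the plaque of `z` to the leaf coordinate `u'`
  have hsubτ : plaque e' τ ⊆ F.leaf x := by
    convert F.plaque_subset_leaf_of_mem he' z.2 (mem_plaque_self hzs) using 2
    exact hzt.symm
  set z' : F.Leaf x := Leaf.mk (e'.symm (u', τ)) (hsubτ (plaqueMap_mem_plaque F he' _ _)) with hz'
  set cτ := leafArc e' τ hsubτ he' with hcτ
  have hzS : z ∈ cτ.source := (mem_leafArc_source_iff hsubτ he').2 ⟨hzs, by rw [hez]⟩
  have hz'S : z' ∈ cτ.source := (mem_leafArc_source_iff hsubτ he').2 (plaqueMap_mem_plaque F he' _ _)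
  have hpz' : ¬ leafLT hbi z' p := by
    intro hlt
    -- then `p ∈ [z', z]` would lie on the plaque of `z`
    have hmem := mem_leafArc_source_of_between he' hsubτ hz'S hzS (leafLT_asymm hlt) (leafLT_asymm hpz)
    have : Leaf.pt p ∈ plaque e' (ht e' z) := by rw [hzt]; exact (mem_leafArc_source_iff hsubτ he').1 hmem
    exact hpoff this
  refine ⟨ι (Leaf.pt z'), hball ?_, ⟨z', hpz', rfl⟩⟩
  show (u', τ) ∈ Metric.ball (u', t) δ₁
  rw [Metric.mem_ball, Prod.dist_eq, max_lt_iff, dist_self, Real.dist_eq]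
  exact ⟨hδ₁, by rw [abs_lt]; constructor <;> linarith [hτ'.1, hτ'.2]⟩

/-- ω-membership is constant along leaves. [folklore] -/
theorem mem_omegaSet_iff_of_mem_leaf (hι : IsOpenEmbedding ι) {y y' : X} (hy' : y' ∈ F.leaf y) :
    ι y ∈ omegaSet hbi ι x ↔ ι y' ∈ omegaSet hbi ι x := by
  induction hy' with
  | rel a b hab =>
    obtain ⟨e', he', hae, hbe, hab'⟩ := hab
    exact ⟨fun h ↦ mem_omegaSet_of_mem_plaque he' hι h hae ⟨hbe, hab'.symm⟩,
      fun h ↦ mem_omegaSet_of_mem_plaque he' hι h hbe ⟨hae, hab'⟩⟩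
  | refl => exact Iff.rfl
  | symm a b _ ih => exact ih.symm
  | trans a b c _ _ ih₁ ih₂ => exact ih₁.trans ih₂

/-- **The ω-limit set is saturated**: with a regular point it contains the whole leaf of that
point. [folklore] -/
theorem mem_omegaSet_of_mem_leaf (hι : IsOpenEmbedding ι) {y y' : X} (hy : ι y ∈ omegaSet hbi ι x) (hy' : y' ∈ F.leaf y) :
    ι y' ∈ omegaSet hbi ι x :=
  (mem_omegaSet_iff_of_mem_leaf hι hy').1 hy

/-! ## The ω-limit set meets each vertical at most once -/

/-- **A crossing near an ω-limit point on the vertical.** If `e⁻¹ (u₀, s)` is an ω-limit point of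
the open leaf, there are crossings of the vertical at heights arbitrarily close to `s`. [folklore] -/
theorem exists_crossing_near₀ (he : e ∈ F.atlas) (hι : IsOpenEmbedding ι) {s : ℝ}
    (hy : ι (e.symm (u₀, s)) ∈ omegaSet hbi ι x) {ε : ℝ} (hε : 0 < ε) :
    ∃ c : F.Leaf x, IsCrossing e u₀ c ∧ |ht e c - s| < ε := by
  set Φ := fun w : ℝ × ℝ ↦ ι (e.symm w) with hΦ
  have hΦ' : IsOpenEmbedding Φ := isOpenEmbedding_symm he hι
  set B : Set (ℝ × ℝ) := Ioo (u₀ - ε) (u₀ + ε) ×ˢ Ioo (s - ε) (s + ε) with hB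
  have hBo : IsOpen (Φ '' B) := hΦ'.isOpenMap _ (isOpen_Ioo.prod isOpen_Ioo)
  have hyB : ι (e.symm (u₀, s)) ∈ Φ '' B := ⟨(u₀, s), ⟨⟨by linarith, by linarith⟩, by linarith, by linarith⟩, rfl⟩
  have hcl := (mem_omegaSet_iff.1 hy) (Leaf.base F x)
  obtain ⟨_, ⟨⟨u, t⟩, ⟨-, htB⟩, rfl⟩, ⟨z, -, hzEq⟩⟩ := mem_closure_iff_nhds.1 hcl _ (hBo.mem_nhds hyB)
  have hzpt : Leaf.pt z = e.symm (u, t) := (hι.injective hzEq).symm ▸ rfl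
  have hzs : Leaf.pt z ∈ e.source := by rw [hzpt]; exact e.map_target (by rw [F.target_eq e he]; exact mem_univ _)
  have hez : e (Leaf.pt z) = (u, t) := by rw [hzpt, e.right_inv (by rw [F.target_eq e he]; exact mem_univ _)]
  have hzt : ht e z = t := by show (e (Leaf.pt z)).2 = t; rw [hez]
  have ht' : t ∈ Ioo (s - ε) (s + ε) := htB
  refine ⟨toVert he u₀ z hzs, isCrossing_toVert he z hzs, ?_⟩
  rw [ht_toVert, hzt, abs_lt]
  constructor <;> linarith [ht'.1, ht'.2]

/-- **Crossings near an ω-limit point on the vertical, after a given crossing.** If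
`e⁻¹ (u₀, s)` is an ω-limit point and `p₀` a crossing at height `≠ s`, then after `p₀` there are
crossings at heights within any `ε ≤ |ht p₀ - s|` of `s`. [folklore] -/
theorem exists_crossing_near (he : e ∈ F.atlas) (hι : IsOpenEmbedding ι) {s : ℝ}
    (hy : ι (e.symm (u₀, s)) ∈ omegaSet hbi ι x) {p₀ : F.Leaf x} (hp₀ : IsCrossing e u₀ p₀) (hne : ht e p₀ ≠ s)
    {ε : ℝ} (hε : 0 < ε) (hε' : ε ≤ |ht e p₀ - s|) :
    ∃ c, leafLT hbi p₀ c ∧ IsCrossing e u₀ c ∧ |ht e c - s| < ε := by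
  have hp₀s : Leaf.pt p₀ ∈ e.source := hp₀.1
  set t₀ := ht e p₀ with ht₀
  have hsub : plaque e t₀ ⊆ F.leaf x := F.plaque_subset_leaf_of_mem he p₀.2 (mem_plaque_self hp₀s)
  set c₀ := leafArc e t₀ hsub he with hc₀
  have hp₀S : p₀ ∈ c₀.source := (mem_leafArc_source_iff hsub he).2 (mem_plaque_self hp₀s)
  set Φ := fun w : ℝ × ℝ ↦ ι (e.symm w) with hΦ
  have hΦ' : IsOpenEmbedding Φ := isOpenEmbedding_symm he hι
  -- Case (b): the plaque of `p₀` unbounded above — then every ω-limit point in the box is on it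
  by_cases hbdd : ∃ p₁ : F.Leaf x, ∀ w ∈ c₀.source, leafLT hbi w p₁
  swap
  · exfalso
    push Not at hbdd
    set p : F.Leaf x := Leaf.mk (e.symm (u₀ + 1, t₀)) (hsub (plaqueMap_mem_plaque F he _ _)) with hp
    have hpS : p ∈ c₀.source := (mem_leafArc_source_iff hsub he).2 (plaqueMap_mem_plaque F he _ _)
    have hfwd : ∀ z ∈ fwd hbi p, z ∈ c₀.source := by
      intro z hz
      obtain ⟨w, hwS, hzw⟩ := hbdd z
      exact mem_leafArc_source_of_between he hsub hpS hwS hz hzw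
    have hcl := (mem_omegaSet_iff.1 hy) p
    have himg : (fun z : F.Leaf x ↦ ι (Leaf.pt z)) '' fwd hbi p ⊆ Φ '' (univ ×ˢ {t₀}) := by
      rintro _ ⟨z, hz, rfl⟩
      have hzpl : Leaf.pt z ∈ plaque e t₀ := (mem_leafArc_source_iff hsub he).1 (hfwd z hz)
      refine ⟨((e (Leaf.pt z)).1, t₀), ⟨mem_univ _, rfl⟩, ?_⟩
      show ι (e.symm ((e (Leaf.pt z)).1, t₀)) = ι (Leaf.pt z)
      rw [← hzpl.2, show ((e (Leaf.pt z)).1, (e (Leaf.pt z)).2) = e (Leaf.pt z) from rfl, e.left_inv hzpl.1]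
    have hclosed : IsClosed (Φ '' (univ ×ˢ {t₀}) ∪ (range Φ)ᶜ) := by
      have hC : IsClosed ((univ : Set ℝ) ×ˢ ({t₀} : Set ℝ)) := isClosed_univ.prod isClosed_singleton
      rw [← isOpen_compl_iff, compl_union, compl_compl]
      have : (Φ '' (univ ×ˢ {t₀}))ᶜ ∩ range Φ = Φ '' (univ ×ˢ {t₀})ᶜ := by
        ext w
        constructor
        · rintro ⟨hw, ⟨v, rfl⟩⟩
          exact ⟨v, fun hv ↦ hw ⟨v, hv, rfl⟩, rfl⟩
        · rintro ⟨v, hv, rfl⟩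
          exact ⟨fun ⟨v', hv', hEq⟩ ↦ hv (hΦ'.injective hEq ▸ hv'), v, rfl⟩
      rw [this]
      exact hΦ'.isOpenMap _ hC.isOpen_compl
    have hmem : ι (e.symm (u₀, s)) ∈ Φ '' (univ ×ˢ {t₀}) ∪ (range Φ)ᶜ :=
      (hclosed.closure_subset_iff.2 (himg.trans subset_union_left)) hcl
    rcases hmem with ⟨⟨u, t⟩, ⟨-, ht⟩, hEq⟩ | hnot
    · have := hΦ'.injective hEq
      have htt : t = s := (Prod.ext_iff.1 this).2
      have htt₀ : t = t₀ := ht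
      exact hne (htt₀.symm.trans htt)
    · exact hnot ⟨(u₀, s), rfl⟩
  -- Case (a): `p₁` beyond the plaque of `p₀`
  obtain ⟨p₁, hp₁⟩ := hbdd
  have hp₀p₁ : leafLT hbi p₀ p₁ := hp₁ p₀ hp₀S
  set B : Set (ℝ × ℝ) := Ioo (u₀ - ε) (u₀ + ε) ×ˢ Ioo (s - ε) (s + ε) with hB
  have hBo : IsOpen (Φ '' B) := hΦ'.isOpenMap _ (isOpen_Ioo.prod isOpen_Ioo)
  have hyB : ι (e.symm (u₀, s)) ∈ Φ '' B := ⟨(u₀, s), ⟨⟨by linarith, by linarith⟩, by linarith, by linarith⟩, rfl⟩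
  have hcl := (mem_omegaSet_iff.1 hy) p₁
  obtain ⟨_, ⟨⟨u, t⟩, ⟨-, htB⟩, rfl⟩, ⟨z, hz, hzEq⟩⟩ := mem_closure_iff_nhds.1 hcl _ (hBo.mem_nhds hyB)
  have hzpt : Leaf.pt z = e.symm (u, t) := (hι.injective hzEq).symm ▸ rfl
  have hzs : Leaf.pt z ∈ e.source := by rw [hzpt]; exact e.map_target (by rw [F.target_eq e he]; exact mem_univ _)
  have hez : e (Leaf.pt z) = (u, t) := by rw [hzpt, e.right_inv (by rw [F.target_eq e he]; exact mem_univ _)]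
  have hzt : ht e z = t := by show (e (Leaf.pt z)).2 = t; rw [hez]
  have ht' : t ∈ Ioo (s - ε) (s + ε) := htB
  have htne : t ≠ t₀ := by
    intro htt
    have h1 : |t - s| < ε := by rw [abs_lt]; constructor <;> linarith [ht'.1, ht'.2]
    rw [htt] at h1
    linarith
  have hp₀z : leafLT hbi p₀ z := by
    rcases not_leafLT_iff.1 hz with h | h
    · exact leafLT_trans hp₀p₁ h
    · exact h ▸ hp₀p₁
  refine ⟨toVert he u₀ z hzs, ?_, isCrossing_toVert he z hzs, ?_⟩
  · refine leafLT_toVert he hzs hp₀z ?_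
    rintro ⟨-, hh⟩
    rw [hzt] at hh
    exact htne (hh ▸ rfl)
  · rw [ht_toVert, hzt, abs_lt]
    constructor <;> linarith [ht'.1, ht'.2]

/-- The asymmetric core of `omegaSet_vert_subsingleton`. [folklore] -/
theorem omegaSet_vert_aux (he : e ∈ F.atlas) (hι : IsOpenEmbedding ι) {s₁ s₂ : ℝ} (hlt : s₁ < s₂)
    (h₁ : ι (e.symm (u₀, s₁)) ∈ omegaSet hbi ι x) (h₂ : ι (e.symm (u₀, s₂)) ∈ omegaSet hbi ι x) : False := by
  set ε := (s₂ - s₁) / 3 with hε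
  have hεpos : 0 < ε := by rw [hε]; linarith
  set T₁ := s₁ - (s₂ - s₁) with hT₁
  set T₂ := s₂ + (s₂ - s₁) with hT₂
  have hW₁ : ∀ c : F.Leaf x, |ht e c - s₁| < ε → ht e c ∈ Ioo T₁ T₂ := fun c hc ↦ by
    rw [abs_lt] at hc; exact ⟨by linarith [hc.1], by linarith [hc.2]⟩
  have hW₂ : ∀ c : F.Leaf x, |ht e c - s₂| < ε → ht e c ∈ Ioo T₁ T₂ := fun c hc ↦ by
    rw [abs_lt] at hc; exact ⟨by linarith [hc.1], by linarith [hc.2]⟩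
  -- an initial crossing `a₀` near `s₁`, then `b > a₀` near `s₂`
  obtain ⟨a₀, ha₀, ha₀s⟩ := exists_crossing_near₀ (hbi := hbi) he hι h₁ hεpos
  have ha₀s₂ : ε ≤ |ht e a₀ - s₂| := by
    rw [abs_lt] at ha₀s
    rw [abs_of_neg (by linarith [ha₀s.2])]
    linarith [ha₀s.2]
  have ha₀ne : ht e a₀ ≠ s₂ := fun h ↦ by rw [h, sub_self, abs_zero] at ha₀s₂; linarith
  obtain ⟨b, ha₀b, hb, hbs⟩ := exists_crossing_near (hbi := hbi) he hι h₂ ha₀ ha₀ne hεpos ha₀s₂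
  have ha₀W : IsWCrossing e u₀ T₁ T₂ a₀ := ⟨ha₀, hW₁ a₀ ha₀s⟩
  have hbW : IsWCrossing e u₀ T₁ T₂ b := ⟨hb, hW₂ b hbs⟩
  -- the first window crossing `c₁` after `a₀` (up to `b`): `(a₀, c₁)` is a consecutive window pair
  obtain ⟨c₁, hc₁W, ha₀c₁, hc₁b, hcons⟩ : ∃ c₁, IsWCrossing e u₀ T₁ T₂ c₁ ∧ leafLT hbi a₀ c₁ ∧ ¬ leafLT hbi b c₁ ∧
      ∀ w, leafLT hbi a₀ w → leafLT hbi w c₁ → IsCrossing e u₀ w → ht e w ∉ Ioo T₁ T₂ := by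
    set S : Set (F.Leaf x) := {w ∈ leafIcc hbi a₀ b | IsCrossing e u₀ w ∧ ht e w ∈ Icc T₁ T₂} ∩
      {w | IsWCrossing e u₀ T₁ T₂ w ∧ leafLT hbi a₀ w} with hS
    have hSf : S.Finite :=
      (finite_crossings_leafIcc hbi he isClosed_Icc (Metric.isBounded_Icc _ _) a₀ b).inter_of_left _
    have hbS : b ∈ S := ⟨⟨right_mem_leafIcc (leafLT_asymm ha₀b), hb, Ioo_subset_Icc_self hbW.2⟩, hbW, ha₀b⟩
    obtain ⟨n, hn⟩ := exists_subset_lineCharts_source (hbi := hbi) (isCompact_leafIcc (hbi := hbi) a₀ b)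
    obtain ⟨c₁, hc₁S, hc₁min⟩ := Set.exists_min_image S (lineCharts hbi x n) hSf ⟨b, hbS⟩
    refine ⟨c₁, hc₁S.2.1, hc₁S.2.2, hc₁S.1.1.2, fun w ha₀w hwc₁ hw hwT ↦ ?_⟩
    have hwb : leafLT hbi w b := by
      rcases not_leafLT_iff.1 hc₁S.1.1.2 with h | h
      · exact leafLT_trans hwc₁ h
      · exact h ▸ hwc₁
    have hwS : w ∈ S := ⟨⟨⟨leafLT_asymm ha₀w, leafLT_asymm hwb⟩, hw, Ioo_subset_Icc_self hwT⟩, ⟨hw, hwT⟩, ha₀w⟩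
    have hle := hc₁min w hwS
    have hlt' := (leafLT_iff (hn hwS.1.1) (hn hc₁S.1.1)).1 hwc₁
    linarith
  -- monotonicity after `c₁`
  have mono := fun (r' : F.Leaf x) (hr' : leafLT hbi c₁ r') (hW : IsWCrossing e u₀ T₁ T₂ r') ↦
    wcrossing_monotone (hbi := hbi) he hι ha₀c₁ ha₀W hc₁W hcons hr' hW
  -- `r₁ > b` near `s₁`, `r₂ > r₁` near `s₂`
  have hbs₁ : ε ≤ |ht e b - s₁| := by
    rw [abs_lt] at hbs
    rw [abs_of_pos (by linarith [hbs.1])]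
    linarith [hbs.1]
  have hbne : ht e b ≠ s₁ := fun h ↦ by rw [h, sub_self, abs_zero] at hbs₁; linarith
  obtain ⟨r₁, hbr₁, hr₁, hr₁s⟩ := exists_crossing_near (hbi := hbi) he hι h₁ hb hbne hεpos hbs₁
  have hr₁s₂ : ε ≤ |ht e r₁ - s₂| := by
    rw [abs_lt] at hr₁s
    rw [abs_of_neg (by linarith [hr₁s.2])]
    linarith [hr₁s.2]
  have hr₁ne : ht e r₁ ≠ s₂ := fun h ↦ by rw [h, sub_self, abs_zero] at hr₁s₂; linarith
  obtain ⟨r₂, hr₁r₂, hr₂, hr₂s⟩ := exists_crossing_near (hbi := hbi) he hι h₂ hr₁ hr₁ne hεpos hr₁s₂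
  have hr₁W : IsWCrossing e u₀ T₁ T₂ r₁ := ⟨hr₁, hW₁ r₁ hr₁s⟩
  have hr₂W : IsWCrossing e u₀ T₁ T₂ r₂ := ⟨hr₂, hW₂ r₂ hr₂s⟩
  have hc₁r₁ : leafLT hbi c₁ r₁ := by
    rcases not_leafLT_iff.1 hc₁b with h | h
    · exact leafLT_trans h hbr₁
    · exact h ▸ hbr₁
  -- the two steps `b → r₁` (down) and `r₁ → r₂` (up) have the same sign as `dir`: absurd
  have hstep₁ : 0 < (ht e r₁ - ht e b) * (ht e c₁ - ht e a₀) := by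
    rcases not_leafLT_iff.1 hc₁b with h | h
    · exact (mono r₁ hc₁r₁ hr₁W).2 b hbW h hbr₁
    · rw [← h]; exact (mono r₁ hc₁r₁ hr₁W).1
  have hstep₂ : 0 < (ht e r₂ - ht e r₁) * (ht e c₁ - ht e a₀) :=
    (mono r₂ (leafLT_trans hc₁r₁ hr₁r₂) hr₂W).2 r₁ hr₁W hc₁r₁ hr₁r₂
  rw [abs_lt] at hbs hr₁s hr₂s
  have hd₁ : ht e r₁ - ht e b < 0 := by linarith [hr₁s.2, hbs.1]
  have hd₂ : 0 < ht e r₂ - ht e r₁ := by linarith [hr₂s.1, hr₁s.2]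
  nlinarith

/-- **The ω-limit set of an open leaf meets each vertical of a flow box in at most one point**
(Poincaré–Bendixson). After the first two crossings in a window around the two heights, the
crossings progress monotonically (`wcrossing_monotone`) and cannot keep returning near both.
[folklore] -/
theorem omegaSet_vert_subsingleton (he : e ∈ F.atlas) (hι : IsOpenEmbedding ι) {s₁ s₂ : ℝ}
    (h₁ : ι (e.symm (u₀, s₁)) ∈ omegaSet hbi ι x) (h₂ : ι (e.symm (u₀, s₂)) ∈ omegaSet hbi ι x) : s₁ = s₂ := by
  by_contra hne
  rcases lt_or_gt_of_ne hne with h | h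
  · exact omegaSet_vert_aux he hι h h₁ h₂
  · exact omegaSet_vert_aux he hι h h₂ h₁

/-! ## Regular ω-limit leaves are closed or separatrices -/

/-- The ω-limit set of a leaf lying in `ω(L)` lies in `ω(L)`. [folklore] -/
theorem omegaSet_subset_of_mem_omegaSet (hι : IsOpenEmbedding ι) {y : X} [NoncompactSpace (F.Leaf y)]
    (hy : ι y ∈ omegaSet hbi ι x) : omegaSet hbi ι y ⊆ omegaSet hbi ι x := by
  intro w hw
  have hcl : w ∈ closure ((fun q : F.Leaf y ↦ ι (Leaf.pt q)) '' fwd hbi (Leaf.base F y)) := (mem_omegaSet_iff.1 hw) _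
  refine (isClosed_omegaSet.closure_subset_iff.2 ?_) hcl
  rintro _ ⟨q, -, rfl⟩
  exact mem_omegaSet_of_mem_leaf hι hy q.2

/-- **Poincaré–Bendixson trichotomy, open case.** If a regular point `y` is an ω-limit point of
an open leaf `L` and the leaf `L_y` of `y` is itself open, then `L_y` has no regular ω-limit
point: it leaves every flow box for good (a *separatrix*). Otherwise a regular ω-limit point
`y'` of `L_y` gives crossings of `L_y` with the vertical through `y'` near `y'`; all points of
`L_y` are in `ω(L)` (saturation), so by `omegaSet_vert_subsingleton` such a crossing is `y'`
itself, and then `L_y` accumulates on its own point `y'`, contradicting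
`not_mem_omegaSet_self`. Hence a regular ω-limit leaf with a regular ω-limit point of its own is
compact (a closed leaf). [folklore] -/
theorem not_mem_omegaSet_of_mem_omegaSet (hι : IsOpenEmbedding ι) {y : X} [NoncompactSpace (F.Leaf y)]
    (hy : ι y ∈ omegaSet hbi ι x) (y' : X) : ι y' ∉ omegaSet hbi ι y := by
  intro hy'
  have hsub := omegaSet_subset_of_mem_omegaSet (hbi := hbi) hι hy
  have hy'L : ι y' ∈ omegaSet hbi ι x := hsub hy'
  obtain ⟨e, he, hy'e⟩ := F.exists_mem_source y'
  set u₀ := (e y').1 with hu₀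
  set s' := (e y').2 with hs'
  have hy'eq : y' = e.symm (u₀, s') := by rw [show (u₀, s') = e y' from rfl, e.left_inv hy'e]
  rw [hy'eq] at hy' hy'L
  -- a crossing `c` of `L_y` with the vertical through `y'`, at height within `1` of `s'`
  obtain ⟨c, hc, -⟩ := exists_crossing_near₀ (hbi := hbi) (x := y) he hι hy' one_pos
  -- its point is in `ω(L)`, on the same vertical: it is `y'`
  have hcω : ι (e.symm (u₀, ht e c)) ∈ omegaSet hbi ι x := by
    rw [← hc.pt_eq]; exact mem_omegaSet_of_mem_leaf hι hy c.2
  have hts : ht e c = s' := omegaSet_vert_subsingleton (hbi := hbi) he hι hcω hy'L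
  have hcy' : ι (Leaf.pt c) = ι (e.symm (u₀, s')) := by rw [hc.pt_eq, hts]
  -- so `L_y` accumulates on its own point `c`
  exact not_mem_omegaSet_self hbi hι c (hcy' ▸ hy')

end Literature.Topology.PlanarFoliations
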